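import Literature.Probability.LatticeModels.ProdBernoulliIndependence
import Literature.Probability.LatticeModels.SahiThirdOrderCorrelation
import Literature.Probability.Percolation.PercolationEvents
import HarnessLib

/-!
# STAR½ (`F = E₃ − ½(m_abc − m_am_bm_c) ≥ 0`): the degenerate target configurations, on EVERY finite graph

Support file for the Sahi programme (`--supports stmt-CriticalPhenomena-4575`, prover prim-sahi-p2 gen 19).  No definitions, no named
facts, no sorries; standard axioms.  Memo `FROM-prim-nh-lead-4575-g120-STAR-HALF.md` §0, §7(c) (lead g120), `prim-sahi-p2/PROOF-E3.md` (29j) step (0).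

The lead's CONJECTURE STAR½ — `3P(ABC) + 3P(A)P(B)P(C) ≥ 2Σ_cyc P(A)P(BC)` for the root-connection events of bond percolation, i.e.
`F := E₃ − ½(P(ABC) − P(A)P(B)P(C)) ≥ 0` — is a THEOREM on apex-forests (C½, paper) and its content lies in three distinct targets: the degenerate
configurations are Harris-trivial for ALL graphs and indeed for arbitrary increasing events under any product measure `prodBernoulli p`:
* `starHalf_nonneg_of_eq` (two slots equal, `B = A`): with `x = P(A)`, `z = P(C)`, `j = P(A∩C)`, `2F = j(3−4x) + xz(3x−2)`, and Harris
  `xz ≤ j ≤ z` gives `2F ≥ xz(1−x)` (`x ≤ 3/4`) resp. `2F ≥ 3z(1−x)²` (`x > 3/4`);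
* `starHalf_nonneg_of_univ` (one slot the sure event, e.g. a target at the root): `F = ½·Cov(B,C) ≥ 0`.
These are the base cases of the C½ induction ((29j)); the real-arithmetic cores are `starHalf_eq_real`, and the event versions take
`IsUpperSet` events of `Set ι` under `prodBernoulli p` (so they apply verbatim to `{s↔a}, {s↔c}`).
-/

noncomputable section

namespace Summit.CriticalPhenomena.PercolationContinuityZ3.Theorems

namespace IncStar

open MeasureTheory Set Literature.Probability.Percolation Literature.Probability.LatticeModels
open scoped Classical

/-- Real arithmetic of the coincident case: `0 ≤ j(3−4x) + xz(3x−2)` for `0 ≤ x ≤ 1`, `0 ≤ z`, `xz ≤ j ≤ z`. [this work] -/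
theorem starHalf_eq_real (x z j : ℝ) (hx0 : 0 ≤ x) (hx1 : x ≤ 1) (hz : 0 ≤ z) (hjl : x * z ≤ j) (hju : j ≤ z) :
    0 ≤ j * (3 - 4 * x) + x * z * (3 * x - 2) := by
  by_cases h : 4 * x ≤ 3
  · -- `j ≥ xz`: `≥ xz(3−4x) + xz(3x−2) = xz(1−x)`
    nlinarith [mul_le_mul_of_nonneg_right hjl (by linarith : (0 : ℝ) ≤ 3 - 4 * x), mul_nonneg (mul_nonneg hx0 hz) (sub_nonneg.2 hx1)]
  · -- `j ≤ z`: `≥ z(3−4x) + xz(3x−2) = 3z(1−x)²`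
    push Not at h
    nlinarith [mul_le_mul_of_nonpos_right hju (by linarith : (3 : ℝ) - 4 * x ≤ 0), mul_nonneg hz (sq_nonneg (1 - x))]

variable {ι : Type*}

/-- **STAR½ with two equal slots, every product measure.**  For increasing measurable `A, C ⊆ Set ι`:
`0 ≤ E₃(A,A,C) − ½(P(A∩C) − P(A)²P(C))` under `prodBernoulli p`. [this work] -/
theorem starHalf_nonneg_of_eq (p : ι → unitInterval) {A C : Set (Set ι)} (hA : IsUpperSet A) (hC : IsUpperSet C)
    (hAm : MeasurableSet A) (hCm : MeasurableSet C) :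
    0 ≤ sahiE3 (prodBernoulli p) A A C
      - 1 / 2 * ((prodBernoulli p).real (A ∩ A ∩ C) - (prodBernoulli p).real A * (prodBernoulli p).real A * (prodBernoulli p).real C) := by
  have hj : (prodBernoulli p).real A * (prodBernoulli p).real C ≤ (prodBernoulli p).real (A ∩ C) := prodBernoulli_harris p hA hC hAm hCm
  have hju : (prodBernoulli p).real (A ∩ C) ≤ (prodBernoulli p).real C := measureReal_mono Set.inter_subset_right
  have hx0 : 0 ≤ (prodBernoulli p).real A := measureReal_nonneg
  have hx1 : (prodBernoulli p).real A ≤ 1 := measureReal_le_one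
  have hz : 0 ≤ (prodBernoulli p).real C := measureReal_nonneg
  have key := starHalf_eq_real _ _ _ hx0 hx1 hz hj hju
  rw [sahiE3_def, Set.inter_self]
  nlinarith [key]

/-- **STAR½ with a sure slot (a target at the root), every product measure.**  For increasing measurable `B, C`:
`E₃(univ,B,C) − ½(P(B∩C) − P(B)P(C)) = ½·Cov(B,C) ≥ 0`. [this work] -/
theorem starHalf_nonneg_of_univ (p : ι → unitInterval) {B C : Set (Set ι)} (hB : IsUpperSet B) (hC : IsUpperSet C)
    (hBm : MeasurableSet B) (hCm : MeasurableSet C) :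
    0 ≤ sahiE3 (prodBernoulli p) Set.univ B C
      - 1 / 2 * ((prodBernoulli p).real (Set.univ ∩ B ∩ C)
          - (prodBernoulli p).real Set.univ * (prodBernoulli p).real B * (prodBernoulli p).real C) := by
  have h := prodBernoulli_harris p hB hC hBm hCm
  rw [sahiE3_def]
  simp only [Set.univ_inter, probReal_univ, one_mul]
  linarith

end IncStar

end Summit.CriticalPhenomena.PercolationContinuityZ3.Theorems
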